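import Literature.NumberTheory.Automorphic.PlaneLatticesCompanionSelfDualStrata        -- ★ (β2′-i): `norm_condition_iff`, `companion_rescale_identities` (+ ★ (β1) `map_companion_span_eq_self_iff_of_hermite`)
import HarnessLib

/-!
# When does a companion matrix reduce to a SCALAR on a stable Hermite plane lattice?  (Type-(2) elliptic edge count of Kottwitz's Euler–Poincaré function)

Topic `NumberTheory/Automorphic`; namespace `Literature.NumberTheory.Automorphic`.  THEOREMS ONLY (no definition, no instance, no notation, no named fact,
no `sorry`).  Cell `pub/hodgecm-mathlib`, (R2) Euler–Poincaré road, brick (R2-t2)(b) layer (E-β) (B-p08 (g27)): at an unramified non-split place a type-(2)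
elliptic `γ` (companion `C = !![0, −d; 1, t]`, `|t² − 4d| = |ϖ^{2N+1}|` ODD) fixes the ball of radius `N + ½` about an edge midpoint of the tree; the `γ`-stable
self-dual lattices `Λ` (the fixed `K`-vertices, ★ (β2′) strata `Λ(T(k, y, −k−e))`, `k ≤ N`) split into INTERIOR vertices — `C ≡ (t∕2)·1 (mod ϖ)` on `Λ`, all `q + 1`
edges at `Λ` fixed — and BOUNDARY vertices — `C̄` a transvection, one fixed edge (★ `HermitianPlaneIsotropicLinesFinite`).  This file gives the CRITERION in Hermite
coordinates:

* §1 `span_range_transpose_le_iff` — `Λ(B) ≤ Λ(g) ↔ g⁻¹B` integral; `map_le_map_smul_one_iff` — `A·Λ(g) ≤ c·Λ(g) ↔ c⁻¹·g⁻¹Ag` integral (any `A`, `c ≠ 0`).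
* §2 **`companion_scalarReduction_iff_of_hermite`** — for a `C`-stable `Λ(T(k, y, −k−e))` (`y′ := ϖ^{k+e}y`):
  `(C − (t∕2)·1)·Λ ≤ ϖ·Λ ↔ 1 ≤ 2k + e ∧ k + e ≤ N ∧ ϖ^{−(k+1)}(2y′ + t) ∈ 𝒪` — by ★ `norm_condition_iff` at the shifted exponent `2k + e + 1`.
  Hence (§2 corollaries) for `e = 1`: interior iff `k < N`; for `e = 0`: interior iff `1 ≤ k` and `ϖ ∣ z` (`2y′ + t = ϖ^{k}z`).
[cite: Flicker1998UnitaryFL, §6 p. 97] [cite: Macdonald1995, Ch. V §2]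
-/

set_option autoImplicit false

noncomputable section

open scoped ValuativeRel Matrix MatrixGroups
open Matrix ValuativeRel

namespace Literature.NumberTheory.Automorphic

variable {F : Type*} [Field F] [ValuativeRel F] {ϖ : F} (hϖ : IsUniformizingElement ϖ)

/-! ## §1 `A·Λ(g) ≤ c·Λ(g)` in coordinates -/

section Coordinates

variable {n : ℕ}

/-- **`Λ(B) ≤ Λ(g) ↔ g⁻¹B` has integral entries** (`g` invertible, `B` any matrix; columns of `B` are `𝒪`-combinations of the columns of `g`).
[cite: Macdonald1995, Ch. V §2] -/
theorem span_range_transpose_le_iff (g : GL (Fin n) F) (B : Matrix (Fin n) (Fin n) F) :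
    Submodule.span 𝒪[F] (Set.range Bᵀ) ≤ Submodule.span 𝒪[F] (Set.range ((g : Matrix (Fin n) (Fin n) F))ᵀ) ↔
      ∀ i j, (((g⁻¹ : GL (Fin n) F) : Matrix (Fin n) (Fin n) F) * B) i j ∈ 𝒪[F] := by
  have hinj : Function.Injective ((Matrix.toLin' (g : Matrix (Fin n) (Fin n) F)).restrictScalars 𝒪[F]) := fun v w hvw => by
    have h := congrArg (fun x => ((g⁻¹ : GL (Fin n) F) : Matrix (Fin n) (Fin n) F) *ᵥ x) hvw
    simpa only [LinearMap.coe_restrictScalars, Matrix.toLin'_apply, Matrix.mulVec_mulVec, ← Units.val_mul, inv_mul_cancel,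
      Units.val_one, Matrix.one_mulVec] using h
  have h1 : (Submodule.span 𝒪[F] (Set.range (((g⁻¹ : GL (Fin n) F) : Matrix (Fin n) (Fin n) F) * B)ᵀ)).map
        ((Matrix.toLin' (g : Matrix (Fin n) (Fin n) F)).restrictScalars 𝒪[F]) = Submodule.span 𝒪[F] (Set.range Bᵀ) := by
    rw [← span_range_transpose_mul, ← Matrix.mul_assoc, ← Units.val_mul, mul_inv_cancel, Units.val_one, Matrix.one_mul]
  have h2 : (Submodule.span 𝒪[F] (Set.range (1 : Matrix (Fin n) (Fin n) F)ᵀ)).map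
        ((Matrix.toLin' (g : Matrix (Fin n) (Fin n) F)).restrictScalars 𝒪[F]) = Submodule.span 𝒪[F] (Set.range ((g : Matrix (Fin n) (Fin n) F))ᵀ) := by
    rw [← span_range_transpose_mul, Matrix.mul_one]
  rw [← h1, ← h2, Submodule.map_le_map_iff_of_injective hinj]
  exact span_range_transpose_le_one_iff _

/-- **`A·Λ(g) ≤ c·Λ(g) ↔ c⁻¹·(g⁻¹ A g)` has integral entries** (`c ≠ 0`; `A` arbitrary, e.g. `γ − a·1` singular). [cite: Macdonald1995, Ch. V §2] -/
theorem map_le_map_smul_one_iff (g : GL (Fin n) F) (A : Matrix (Fin n) (Fin n) F) {c : F} (hc : c ≠ 0) :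
    (Submodule.span 𝒪[F] (Set.range ((g : Matrix (Fin n) (Fin n) F))ᵀ)).map ((Matrix.toLin' A).restrictScalars 𝒪[F]) ≤
        (Submodule.span 𝒪[F] (Set.range ((g : Matrix (Fin n) (Fin n) F))ᵀ)).map
          ((Matrix.toLin' (c • (1 : Matrix (Fin n) (Fin n) F))).restrictScalars 𝒪[F]) ↔
      ∀ i j, (c⁻¹ • (((g⁻¹ : GL (Fin n) F) : Matrix (Fin n) (Fin n) F) * A * (g : Matrix (Fin n) (Fin n) F))) i j ∈ 𝒪[F] := by
  -- the scalar `c` as an element of `GL_n`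
  have hcu : (c • (1 : Matrix (Fin n) (Fin n) F)) * (c⁻¹ • (1 : Matrix (Fin n) (Fin n) F)) = 1 := by
    rw [smul_mul_smul_comm, mul_inv_cancel₀ hc, Matrix.mul_one, one_smul]
  have hcu' : (c⁻¹ • (1 : Matrix (Fin n) (Fin n) F)) * (c • (1 : Matrix (Fin n) (Fin n) F)) = 1 := by
    rw [smul_mul_smul_comm, inv_mul_cancel₀ hc, Matrix.mul_one, one_smul]
  set C : GL (Fin n) F := ⟨c • 1, c⁻¹ • 1, hcu, hcu'⟩ with hC
  have hCg : (((g * C : GL (Fin n) F)) : Matrix (Fin n) (Fin n) F) = (c • (1 : Matrix (Fin n) (Fin n) F)) * (g : Matrix (Fin n) (Fin n) F) := by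
    rw [Units.val_mul]
    show (g : Matrix (Fin n) (Fin n) F) * (c • 1) = _
    rw [Matrix.mul_smul, Matrix.mul_one, Matrix.smul_mul, Matrix.one_mul]
  rw [← span_range_transpose_mul, ← span_range_transpose_mul, ← hCg, span_range_transpose_le_iff]
  have hinv : (((g * C)⁻¹ : GL (Fin n) F) : Matrix (Fin n) (Fin n) F) = c⁻¹ • (((g⁻¹ : GL (Fin n) F) : Matrix (Fin n) (Fin n) F)) := by
    rw [_root_.mul_inv_rev, Units.val_mul]
    show (c⁻¹ • (1 : Matrix (Fin n) (Fin n) F)) * _ = _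
    rw [Matrix.smul_mul, Matrix.one_mul]
  rw [hinv, Matrix.smul_mul, Matrix.mul_assoc]

end Coordinates

/-! ## §2 The scalar-reduction criterion for a companion-stable Hermite lattice -/

section Companion

variable [IsDiscreteValuationRing 𝒪[F]]

include hϖ in
/-- **SCALAR REDUCTION IN HERMITE COORDINATES.**  `|2| = 1`, `t ∈ 𝒪`, `|d| = 1`, `|t² − 4d| = |ϖ^{2N+1}|`, `e ≤ 1`, `↑g = T(k, y, −k−e)`, `Λ(g)` `C`-stable
(`C = !![0, −d; 1, t]`), `y′ := ϖ^{k+e} y`: then `(C − (t∕2)·1)·Λ(g) ≤ ϖ·Λ(g)` — i.e. `C` REDUCES TO THE SCALAR `t∕2` on `Λ(g)∕ϖΛ(g)` — iff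
`1 ≤ 2k + e ∧ k + e ≤ N ∧ ϖ^{−(k+1)}(2y′ + t) ∈ 𝒪`.  Proof: the matrix of `C` on `Λ(g)` is `!![−y′, −M; ϖ^{2k+e}, y′ + t]` with
`M = ϖ^{−(2k+e)}(y′² + t y′ + d)` (★ (β1)); `ϖ⁻¹(m − (t∕2)·1)` is integral iff `2k + e ≥ 1`, `ϖ⁻¹(2y′ + t) ∈ 𝒪` and `ϖ^{−(2k+e+1)}(y′² + ty′ + d) ∈ 𝒪`, and the last
is ★ `norm_condition_iff` at the exponent `2k + e + 1 = 2k′ + e′` (`(k′, e′) = (k, 1)` or `(k+1, 0)`). [cite: Flicker1998UnitaryFL, §6 p. 97] [cite: Macdonald1995, Ch. V §2] -/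
theorem companion_scalarReduction_iff_of_hermite (h2 : valuation F 2 = 1) {t d : F} (ht : t ∈ 𝒪[F]) (hd : valuation F d = 1) {e : ℕ} (he : e ≤ 1)
    {N : ℕ} (hD : valuation F (t ^ 2 - 4 * d) = valuation F (ϖ ^ (2 * N + 1))) (γ : GL (Fin 2) F)
    (hγ : (γ : Matrix (Fin 2) (Fin 2) F) = !![0, -d; 1, t]) {k : ℕ} {y : F} (g : GL (Fin 2) F)
    (hg : (g : Matrix (Fin 2) (Fin 2) F) = !![ϖ ^ (k : ℤ), y; 0, ϖ ^ (-(k : ℤ) - e)])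
    (hst : (Submodule.span 𝒪[F] (Set.range ((g : Matrix (Fin 2) (Fin 2) F))ᵀ)).map
        ((Matrix.toLin' (γ : Matrix (Fin 2) (Fin 2) F)).restrictScalars 𝒪[F]) = Submodule.span 𝒪[F] (Set.range ((g : Matrix (Fin 2) (Fin 2) F))ᵀ)) :
    (Submodule.span 𝒪[F] (Set.range ((g : Matrix (Fin 2) (Fin 2) F))ᵀ)).map
          ((Matrix.toLin' ((γ : Matrix (Fin 2) (Fin 2) F) - (t * 2⁻¹) • (1 : Matrix (Fin 2) (Fin 2) F))).restrictScalars 𝒪[F]) ≤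
        (Submodule.span 𝒪[F] (Set.range ((g : Matrix (Fin 2) (Fin 2) F))ᵀ)).map
          ((Matrix.toLin' (ϖ • (1 : Matrix (Fin 2) (Fin 2) F))).restrictScalars 𝒪[F]) ↔
      1 ≤ 2 * k + e ∧ k + e ≤ N ∧ ϖ ^ (-((k + 1 : ℕ) : ℤ)) * (2 * (ϖ ^ (-(-(k : ℤ) - e)) * y) + t) ∈ 𝒪[F] := by
  have h0 := hϖ.ne_zero
  have h20 : (2 : F) ≠ 0 := fun h => by rw [h, map_zero] at h2; exact zero_ne_one h2
  -- unpack stability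
  obtain ⟨-, hyO, hnorm⟩ := (map_companion_span_eq_self_iff_of_hermite hϖ γ g hγ hd ht hg).1 hst
  rw [(companion_rescale_identities h0 (k := k) (e := e) rfl y t d (0 : F) (0 : F) (0 : F)).1] at hnorm
  obtain ⟨hkN, hz⟩ := (norm_condition_iff hϖ h2 ht hD he hyO).1 hnorm
  set y' : F := ϖ ^ (-(-(k : ℤ) - e)) * y with hy'
  -- the matrix `g⁻¹ (γ − c) g = m − c·1`
  rw [map_le_map_smul_one_iff g _ h0]
  have hm : ((g⁻¹ : GL (Fin 2) F) : Matrix (Fin 2) (Fin 2) F) * ((γ : Matrix (Fin 2) (Fin 2) F) - (t * 2⁻¹) • (1 : Matrix (Fin 2) (Fin 2) F)) *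
        (g : Matrix (Fin 2) (Fin 2) F) =
      !![-y' - t * 2⁻¹, -(ϖ ^ (-((2 * k + e : ℕ) : ℤ)) * (y' ^ 2 + t * y' + d)); ϖ ^ (((2 * k + e : ℕ) : ℤ)), y' + t - t * 2⁻¹] := by
    have hconj : ((g⁻¹ : GL (Fin 2) F) : Matrix (Fin 2) (Fin 2) F) * (γ : Matrix (Fin 2) (Fin 2) F) * (g : Matrix (Fin 2) (Fin 2) F) =
        !![-(y * (ϖ ^ (-(k : ℤ) - e))⁻¹), -((ϖ ^ (k : ℤ))⁻¹ * (ϖ ^ (-(k : ℤ) - e))⁻¹ * (y ^ 2 + t * y * ϖ ^ (-(k : ℤ) - e) + d * (ϖ ^ (-(k : ℤ) - e)) ^ 2));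
           ϖ ^ (k : ℤ) * (ϖ ^ (-(k : ℤ) - e))⁻¹, y * (ϖ ^ (-(k : ℤ) - e))⁻¹ + t] := by
      rw [Matrix.coe_units_inv, hg, hγ, upperTriangular_inv_mul_companion_mul (zpow_ne_zero _ h0) (zpow_ne_zero _ h0)]
    have e1 : y * (ϖ ^ (-(k : ℤ) - e))⁻¹ = y' := by rw [hy', ← _root_.zpow_neg, mul_comm]
    have e2 : ϖ ^ (k : ℤ) * (ϖ ^ (-(k : ℤ) - e))⁻¹ = ϖ ^ (((2 * k + e : ℕ) : ℤ)) := by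
      rw [← _root_.zpow_neg, ← zpow_add₀ h0]; congr 1; push_cast; ring
    have e3 : (ϖ ^ (k : ℤ))⁻¹ * (ϖ ^ (-(k : ℤ) - e))⁻¹ * (y ^ 2 + t * y * ϖ ^ (-(k : ℤ) - e) + d * (ϖ ^ (-(k : ℤ) - e)) ^ 2) =
        ϖ ^ (-((2 * k + e : ℕ) : ℤ)) * (y' ^ 2 + t * y' + d) := by
      have : (ϖ ^ (-(k : ℤ) - e)) ^ 2 = ϖ ^ (2 * (-(k : ℤ) - e)) := by rw [← zpow_natCast, ← _root_.zpow_mul, mul_comm]; norm_num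
      rw [this, ← (companion_rescale_identities h0 (k := k) (e := e) rfl y t d (0 : F) (0 : F) (0 : F)).1, ← _root_.zpow_neg, ← _root_.zpow_neg,
        ← zpow_add₀ h0]
      congr 1; ring
    rw [Matrix.mul_sub, Matrix.sub_mul, hconj, e1, e2, e3, Matrix.mul_smul, Matrix.mul_one, Matrix.smul_mul, ← Units.val_mul, inv_mul_cancel,
      Units.val_one]
    ext i j
    fin_cases i <;> fin_cases j <;> simp [Matrix.smul_apply]
  rw [hm]
  -- `ϖ⁻¹(2y′ + t) ∈ 𝒪` and `ϖ^{-(k+1)}(2y′+t) ∈ 𝒪`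
  have hpow : ∀ (a : ℤ) (w : F), ϖ ^ a * w ∈ 𝒪[F] → ∀ b : ℤ, a ≤ b → ϖ ^ b * w ∈ 𝒪[F] := fun a w hw b hab => by
    have : ϖ ^ b * w = ϖ ^ (b - a) * (ϖ ^ a * w) := by rw [← mul_assoc, ← zpow_add₀ h0, sub_add_cancel]
    rw [this]
    exact (𝒪[F]).mul_mem ((zpow_uniformizer_mem_integer_iff hϖ _).2 (by omega)) hw
  have h2i : (2 : F)⁻¹ ∈ 𝒪[F] := (Valuation.mem_integer_iff _ _).2 (by rw [map_inv₀, h2, inv_one])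
  have h2O : (2 : F) ∈ 𝒪[F] := (Valuation.mem_integer_iff _ _).2 h2.le
  -- the four entries of `ϖ⁻¹ • (m − c·1)`
  have hent : (∀ i j : Fin 2, (ϖ⁻¹ • (!![-y' - t * 2⁻¹, -(ϖ ^ (-((2 * k + e : ℕ) : ℤ)) * (y' ^ 2 + t * y' + d)); ϖ ^ (((2 * k + e : ℕ) : ℤ)), y' + t - t * 2⁻¹] :
        Matrix (Fin 2) (Fin 2) F)) i j ∈ 𝒪[F]) ↔
      ϖ ^ (-(1 : ℤ)) * (2 * y' + t) ∈ 𝒪[F] ∧ ϖ ^ (-((2 * k + e + 1 : ℕ) : ℤ)) * (y' ^ 2 + t * y' + d) ∈ 𝒪[F] ∧ 1 ≤ 2 * k + e := by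
    have q00 : ϖ⁻¹ * (-y' - t * 2⁻¹) = -(ϖ ^ (-(1 : ℤ)) * (2 * y' + t)) * 2⁻¹ := by rw [_root_.zpow_neg_one]; field_simp; ring
    have q11 : ϖ⁻¹ * (y' + t - t * 2⁻¹) = (ϖ ^ (-(1 : ℤ)) * (2 * y' + t)) * 2⁻¹ := by rw [_root_.zpow_neg_one]; field_simp; ring
    have q01 : ϖ⁻¹ * -(ϖ ^ (-((2 * k + e : ℕ) : ℤ)) * (y' ^ 2 + t * y' + d)) = -(ϖ ^ (-((2 * k + e + 1 : ℕ) : ℤ)) * (y' ^ 2 + t * y' + d)) := by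
      rw [← _root_.zpow_neg_one, neg_mul_eq_mul_neg, ← mul_assoc, ← zpow_add₀ h0]
      push_cast; ring
    have q10 : ϖ⁻¹ * ϖ ^ (((2 * k + e : ℕ) : ℤ)) = ϖ ^ (((2 * k + e : ℕ) : ℤ) - 1) := by
      rw [← _root_.zpow_neg_one, ← zpow_add₀ h0]; ring_nf
    have hx2 : ∀ w : F, w * 2⁻¹ ∈ 𝒪[F] ↔ w ∈ 𝒪[F] := fun w => by
      rw [Valuation.mem_integer_iff, Valuation.mem_integer_iff, map_mul, map_inv₀, h2, inv_one, mul_one]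
    constructor
    · intro h
      have a00 := h 0 0; have a01 := h 0 1; have a10 := h 1 0
      simp only [Matrix.smul_apply, smul_eq_mul, Matrix.of_apply, Matrix.cons_val', Matrix.cons_val_zero, Matrix.cons_val_one,
        Matrix.cons_val_fin_one, Matrix.empty_val'] at a00 a01 a10
      rw [q00, neg_mul, neg_mem_iff, hx2] at a00
      rw [q01, neg_mem_iff] at a01
      rw [q10, zpow_uniformizer_mem_integer_iff hϖ] at a10
      exact ⟨a00, a01, by omega⟩
    · rintro ⟨ha, hb, hc⟩ i j
      fin_cases i <;> fin_cases j <;>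
        simp only [Fin.zero_eta, Fin.mk_one, Matrix.smul_apply, smul_eq_mul, Matrix.of_apply, Matrix.cons_val', Matrix.cons_val_zero,
          Matrix.cons_val_one, Matrix.cons_val_fin_one, Matrix.empty_val']
      · rw [q00, neg_mul, neg_mem_iff]; exact (hx2 _).2 ha
      · rw [q01, neg_mem_iff]; exact hb
      · rw [q10]; exact (zpow_uniformizer_mem_integer_iff hϖ _).2 (by omega)
      · rw [q11]; exact (hx2 _).2 ha
  rw [hent]
  -- the norm entry at the shifted exponent `2k + e + 1 = 2k′ + e′`
  have hshift : ϖ ^ (-((2 * k + e + 1 : ℕ) : ℤ)) * (y' ^ 2 + t * y' + d) ∈ 𝒪[F] ↔ k + e ≤ N ∧ ϖ ^ (-((k + 1 : ℕ) : ℤ)) * (2 * y' + t) ∈ 𝒪[F] := by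
    rcases Nat.le_one_iff_eq_zero_or_eq_one.1 he with rfl | rfl
    · -- `e = 0`: `(k′, e′) = (k, 1)`
      have := norm_condition_iff hϖ h2 ht hD (k := k) (e := 1) le_rfl hyO
      simpa [Nat.add_zero] using this
    · -- `e = 1`: `(k′, e′) = (k + 1, 0)`
      have := norm_condition_iff hϖ h2 ht hD (k := k + 1) (e := 0) (Nat.zero_le _) hyO
      rw [show 2 * (k + 1) + 0 = 2 * k + 1 + 1 by ring, show k + 1 + 0 = k + 1 from rfl] at this
      exact this
  rw [hshift]
  constructor
  · rintro ⟨-, ⟨hkeN, hk1⟩, h1⟩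
    exact ⟨h1, hkeN, hk1⟩
  · rintro ⟨h1, hkeN, hk1⟩
    exact ⟨hpow _ _ hk1 _ (by push_cast; omega), ⟨hkeN, hk1⟩, h1⟩

end Companion

end Literature.NumberTheory.Automorphic

end
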